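import Summits.HubbardSuperconductivity.HubbardLadder.NeelSignPatternC22S
import Summits.HubbardSuperconductivity.HubbardLadder.NeelRPFreeCorrelationRowsSixD
import Summits.HubbardSuperconductivity.HubbardLadder.NeelRPFreeCorrelationRowsEightD
import Summits.HubbardSuperconductivity.HubbardLadder.NeelRPFreeCorrelationRowsTenD
import Summits.HubbardSuperconductivity.HubbardLadder.NeelRPFreeCorrelationRowsTwelveD
import HarnessLib

/-!
# R2 device D43 (glue) — the strict Néel sign at `(2,2)` on EVERY even torus `L ≥ 6`, energy-free, with an `L`-uniform margin

HONEST FRAMING: ladder R1–R4 with certified numbers; no claim on H/H₀.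

Glue only (no new certificate in this file): for the spin-½ Heisenberg antiferromagnet on the `L×L` torus, `L ≥ 6`
even, tracial ground state, the reduced two-point function `c_L(2,2) = heisRedCorr2 L 1 2 2` (graph distance 4,
Euclidean distance `2√2`) obeys **`c_L(2,2) ≥ 9/5000` for EVERY even `L ≥ 6`** (`heisRedCorr2_C22_floor_allEven`):
`L = 6, 8, 10, 12` from the energy-free finite-torus rows already in the tree (`heisRedCorr2_six_2_2_ge_free` `0.0046`,
`heisRedCorr2_eight_2_2_ge_free` `0.0029`, `heisRedCorr2_ten_2_2_ge_free` `0.0048`, `heisRedCorr2_twelve_2_2_ge_free`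
`0.0046`; files `NeelRPFreeCorrelationRows{Six,Eight,Ten,Twelve}D`), `L ≥ 14` from the D43 window-kernel theorem
`heisRedCorr2_C22_floor` (`9/5000`, every `k ≥ 7`).  Together with `neelSignPattern_allEven` (the classes `(0,1)`, `(1,1)`,
`(0,2)`, `(1,2)`, `(0,3)`, every even `L ≥ 4`) the strict alternating sign `(-1)^(a+b) c_L(a,b) > 0` is thereby
certified, uniformly in even `L ≥ 6`, on the six classes `(0,1)`, `(1,1)`, `(0,2)`, `(1,2)`, `(0,3)`, `(2,2)`.
(`L = 4` is excluded: on the `4×4` torus `(2,2)` is the antipode and no finite row for it is in the tree.)  A statement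
about every finite even torus; NOT a statement about long-range order, nothing about `L → ∞` beyond the uniform
constant, and nothing whatsoever about the Hubbard model.
[cite: KLS1988JSP, eqs. (4), (6)–(9)] [cite: DLS1978, Thm 3.2, App. C] [cite: LiebMattis1962, Theorem 2]
-/

namespace Summit.HubbardSuperconductivity.HubbardLadder

open Literature.MathematicalPhysics.QuantumLattice

/-- **`c_L(2,2) ≥ 9/5000` for EVERY even `L ≥ 6`** (energy-free; `L = 6, 8, 10, 12` from the finite-torus rows `0.0046`,
`0.0029`, `0.0048`, `0.0046` already in the tree, `L ≥ 14` from the D43 kernel theorem `heisRedCorr2_C22_floor`,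
`9/5000`): the strict Néel sign `+` at graph distance 4 on the diagonal, uniformly in the side.
HONEST FRAMING: ladder R1–R4 with certified numbers; no claim on H/H₀.
[cite: KLS1988JSP, eqs. (4), (6)–(9)] [cite: DLS1978, Thm 3.2] -/
theorem heisRedCorr2_C22_floor_allEven (L : ℕ) (hL : 6 ≤ L) (hev : Even L) :
    (9 / 5000 : ℝ) ≤ heisRedCorr2 L 1 2 2 := by
  obtain ⟨k, rfl⟩ := hev
  rcases Nat.lt_or_ge (k + k) 14 with h14 | h14
  · have hk : k = 3 ∨ k = 4 ∨ k = 5 ∨ k = 6 := by omega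
    rcases hk with rfl | rfl | rfl | rfl
    · exact le_trans (by norm_num) heisRedCorr2_six_2_2_ge_free
    · exact le_trans (by norm_num) heisRedCorr2_eight_2_2_ge_free
    · exact le_trans (by norm_num) heisRedCorr2_ten_2_2_ge_free
    · exact le_trans (by norm_num) heisRedCorr2_twelve_2_2_ge_free
  · rw [← two_mul]
    exact le_trans (by norm_num) (heisRedCorr2_C22_floor k (by omega))

/-- **The strict Néel sign at `(2,2)` is positive on every even torus `L ≥ 6`** (corollary of the floor).
HONEST FRAMING: ladder R1–R4 with certified numbers; no claim on H/H₀. [cite: KLS1988JSP, eqs. (4), (6)–(9)] -/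
theorem heisRedCorr2_C22_pos_allEven (L : ℕ) (hL : 6 ≤ L) (hev : Even L) :
    0 < heisRedCorr2 L 1 2 2 :=
  lt_of_lt_of_le (by norm_num) (heisRedCorr2_C22_floor_allEven L hL hev)

end Summit.HubbardSuperconductivity.HubbardLadder
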